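import Literature.MathematicalPhysics.QuantumFieldTheory.Balaban1983to89.Step

/-!
# `Balaban1983to89.B16Ineq182Gluing` — the p.385 gluing chain behind (1.82) of
[Balaban1989LargeFieldII]: arithmetic members proved, (1.82) derived from the (1.79)-shaped
definition of `κ₁(Z)`, and the base case of (1.80) fed to `Step.Budget.base_182` BY NAME

statement-level skeleton of published theorems with citation tags; proofs where landed; nothing here
is a claim about the Yang–Mills mass gap

CITATION HEADER.  Source: T. Bałaban, *Large field renormalization. II. Localization,
exponentiation, and bounds for the 𝐑 operation*, Commun. Math. Phys. **122** (1989) 355–392,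
doi:10.1007/bf01238433, bib `Balaban1989LargeFieldII` (held: `paper:balaban1989-cmp122-large-field-ii`;
journal page = PDF page + 354).  The displays below were READ AS AN IMAGE on the x2 render
`run/shared/lean/pub/pub-balaban/b2b-balaban-ref1/pages/1989-cmp122-large-field-II/…-p031-x2.png`
(= p. 385), not on the OCR layer (which garbles them).  Cell `lit-balaban`, reader/typer `r13`
(block B16), SKELETON row **B16.Txt@385** (the unnumbered displays between (1.81) and (1.82)) and
row **B16.Eq1.82**.

THE PRINTED TEXT (p. 385 [PDF 31], after (1.81)).  *"Now we prove the statement for j = 1. Take a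
component Z of the region Z₁. It is determined by some of the large field regions Z₁⁽ⁱ⁾, in the
sense that the property (1.76) is satisfied, i.e., Z ⊂ ⋃_i (Z₁⁽ⁱ⁾)~². Then
d′₁(Z) ≦ Σ_i d′₁((Z₁⁽ⁱ⁾)~³), and*

  *d′₁((Z₁⁽ⁱ⁾)~³) ≦ 7^d (3·2^{d−1} d′₁(Z₁⁽ⁱ⁾) + 2^d) ≦ 2(14)^d (d′₁(Z₁⁽ⁱ⁾) + ½).*

*This implies*

  *d′₁(Z) + 1 ≦ 2(14)^d Σ_i (d′₁(Z₁⁽ⁱ⁾) + 1),*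

*and*

  *Π_i exp(−½γ₀A₁²p₀²(g₁)(d′₁(Z₁⁽ⁱ⁾) + 1)) ≦ exp(−¼γ₀(14)^{−d}A₁²p₀²(g₁)(d′₁(Z) + 1)).*

*From the definition of κ₁(Z) we get the following bound:*

  *κ₁(Z) ≧ ¼γ₀(14)^{−d}A₁²p₀²(g₁)(d′₁(Z) + 1) − O(1)M^dR₁^{d+1}d′₁(Z).   (1.82)*

*Thus, by the estimate (1.81), the statement holds for j = 1, i.e., the inequality (1.80) holds
for j = 1, if ¼γ₀(14)^{−d}A₁²p₀²(g₁) ≧ O(1)2(64)^dM^dL^{d+1}R₁^{d+2}."*  The "definition of κ₁(Z)"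
is p. 384: *"If Z is a component of Z_j, and j(Z) is the index of a first large field region
contained in Z, then we write the factor connected with Z in the form exp(−κ_j(Z) − 2p₀(g_{j(Z)}))"*
applied to the factors of (1.79) p. 383 (per large field region Z₁⁽ⁱ⁾ a factor
exp(−½γ₀A₁²p₀²(g₁)(d′₁(Z₁⁽ⁱ⁾) + 1) − 2p₀(g₁)), and the cost factor exp(O(1)M^dR₁^{d+1}d′₁(Z₁)) of
the first step); hence, for a component Z determined by the regions i ∈ I_Z,

  κ₁(Z) ≧ Σ_{i∈I_Z} ½γ₀A₁²p₀²(g₁)(d′₁(Z₁⁽ⁱ⁾) + 1) − O(1)M^dR₁^{d+1}d′₁(Z)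

(the surplus terms 2p₀(g₁) of the regions other than the first are ≧ 0 and dropped) — this
lower bound is the hypothesis `hdef` below; nothing else of (1.79) is used.

WHAT IS PROVED (kernel-checked, no `sorry`, no new axioms, every dimension unless said).
* §1 `enlarge_arith`: the ARITHMETIC member of the enlargement display,
  `7^d (3·2^{d−1} x + 2^d) ≤ 2·14^d (x + ½)` for `1 ≤ d`, `0 ≤ x` (false at `d = 0`, where Lean's
  `2^(0−1) = 1`; print has `d ≥ 1`).  Identity behind it: `7^d·3·2^{d−1} = (3/2)·14^d`, `7^d·2^d = 14^d`.
* §2 `gluing`: *"This implies d′₁(Z) + 1 ≦ 2(14)^d Σ_i (d′₁(Z₁⁽ⁱ⁾) + 1)"* — from the two GEOMETRIC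
  members as binders (`hcover`: `d′₁(Z) ≤ Σ_i e_i`, `e_i` standing for `d′₁((Z₁⁽ⁱ⁾)~³)`; `henl`:
  `e_i ≤ 2·14^d (d′₁(Z₁⁽ⁱ⁾) + ½)`) for a NON-EMPTY finite family of regions (a component is
  determined by at least one region); the `+1` is paid by `14^d·#I_Z ≥ 1`.
* §3 `expProd_le`: the exponential comparison, from §2's conclusion and `0 ≤ γ₀`.
* §4 `ineq182_of_def`: (1.82) from `hdef` + the binders; `ineq182_of_gluing`: the same from §2's
  conclusion alone.
* §5 `base180_of_def`: the base case `j = 1` of (1.80) — `Step.Budget.base_182` (cell `pub-balaban`,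
  module `…Step` Part F2, which takes (1.82) as its hypothesis `hκ`) with `hκ` DISCHARGED by §4; the cost
  `O(1)M^dR₁^{d+1}d′₁(Z)` is `Step.Budget.Consts.cost b 1 (d′₁ Z)` and the dimension is `b.d`.
* §6 non-vacuity: a one-region family on which every hypothesis of §4 holds with a strict gain.

WHAT REMAINS A BINDER (named, not hidden).  The two geometric members — the cover inequality
*"d′₁(Z) ≦ Σ_i d′₁((Z₁⁽ⁱ⁾)~³)"* and the cube count *"d′₁((Z₁⁽ⁱ⁾)~³) ≦ 7^d(3·2^{d−1}d′₁(Z₁⁽ⁱ⁾) + 2^d)"*.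
On the cell `pub-balaban`'s sup-metric model of the linear size (`…TreeLength`: `treeLen`,
`card_le_of_sAdmissible_len`) the cube count met by a tree graph is kernel-bracketed but print's
slope `3·2^{d−1}` for TREES is neither confirmed nor refuted (`…B16.SupCountFloor`,
`…B16.SupCountCeiling.slope_bracket`, `…B16.SupCountBranching.tree_slope_bracket_four` /
`printed_vs_star_four`, `…B16.SupCountHalfLattice`; cell DIVERGENCE D-b01g15.1), and the gluing
consequence is carried on that model with the enlargement inequality as a binder by
`…T4SizeLedger.foundation_size_le` / `new_binder_of_gamma`.  This file does not import those
modules; it supplies the printed ARITHMETIC around the binders and the knit to `…Step`.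
-/

namespace Literature.MathematicalPhysics.QuantumFieldTheory.Balaban1983to89.B16Ineq182Gluing

open Finset

/-! ## §1 The arithmetic member of the enlargement display -/

/-- p. 385: *"7^d(3·2^{d−1}d′₁(Z₁⁽ⁱ⁾) + 2^d) ≦ 2(14)^d(d′₁(Z₁⁽ⁱ⁾) + ½)"* — for `d ≥ 1` and a
non-negative size `x = d′₁(Z₁⁽ⁱ⁾)`.  (`7^d·3·2^{d−1}·x + 7^d·2^d = (3/2)·14^d·x + 14^d ≤ 2·14^d·x + 14^d`.)
[cite: Balaban1989LargeFieldII, p.385 display after (1.81)] -/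
theorem enlarge_arith {d : ℕ} (hd : 1 ≤ d) {x : ℝ} (hx : 0 ≤ x) :
    (7 : ℝ) ^ d * (3 * 2 ^ (d - 1) * x + 2 ^ d) ≤ 2 * 14 ^ d * (x + 1 / 2) := by
  obtain ⟨e, rfl⟩ : ∃ e, d = e + 1 := ⟨d - 1, by omega⟩
  rw [Nat.add_sub_cancel]
  have h14 : (14 : ℝ) ^ (e + 1) = 7 ^ (e + 1) * (2 ^ e * 2) := by
    rw [← pow_succ, ← mul_pow]; norm_num
  have hP : (0 : ℝ) ≤ 7 ^ (e + 1) * 2 ^ e := by positivity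
  have lhs : (7 : ℝ) ^ (e + 1) * (3 * 2 ^ e * x + 2 ^ (e + 1)) = 7 ^ (e + 1) * 2 ^ e * (3 * x + 2) := by
    rw [pow_succ]; ring
  have rhs : (2 : ℝ) * 14 ^ (e + 1) * (x + 1 / 2) = 7 ^ (e + 1) * 2 ^ e * (4 * x + 2) := by
    rw [h14]; ring
  rw [lhs, rhs]
  exact mul_le_mul_of_nonneg_left (by linarith) hP

/-- The whole enlargement display for one region, from its geometric first member as a binder:
`d′₁((Z₁⁽ⁱ⁾)~³) ≤ 7^d(3·2^{d−1}d′₁(Z₁⁽ⁱ⁾) + 2^d)` (`hcount`) ⇒ `d′₁((Z₁⁽ⁱ⁾)~³) ≤ 2·14^d(d′₁(Z₁⁽ⁱ⁾) + ½)`.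
[cite: Balaban1989LargeFieldII, p.385 display after (1.81)] -/
theorem enlarge_of_count {d : ℕ} (hd : 1 ≤ d) {x e : ℝ} (hx : 0 ≤ x)
    (hcount : e ≤ (7 : ℝ) ^ d * (3 * 2 ^ (d - 1) * x + 2 ^ d)) :
    e ≤ 2 * 14 ^ d * (x + 1 / 2) :=
  hcount.trans (enlarge_arith hd hx)

/-! ## §2 The gluing consequence -/

/-- p. 385: *"Then d′₁(Z) ≦ Σ_i d′₁((Z₁⁽ⁱ⁾)~³), and d′₁((Z₁⁽ⁱ⁾)~³) ≦ … ≦ 2(14)^d(d′₁(Z₁⁽ⁱ⁾) + ½).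
This implies d′₁(Z) + 1 ≦ 2(14)^d Σ_i (d′₁(Z₁⁽ⁱ⁾) + 1)"*.  Here `s` is the (non-empty, finite) set
of regions determining the component `Z`, `dZ = d′₁(Z)`, `d₁ i = d′₁(Z₁⁽ⁱ⁾)`, `e i = d′₁((Z₁⁽ⁱ⁾)~³)`;
the cover inequality `hcover` and the per-region enlargement bound `henl` are the binders.
[cite: Balaban1989LargeFieldII, p.385 display after (1.81)] -/
theorem gluing {ι : Type*} {s : Finset ι} (hs : s.Nonempty) {d : ℕ} {dZ : ℝ} {d₁ e : ι → ℝ}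
    (hcover : dZ ≤ ∑ i ∈ s, e i) (henl : ∀ i ∈ s, e i ≤ 2 * 14 ^ d * (d₁ i + 1 / 2)) :
    dZ + 1 ≤ 2 * 14 ^ d * ∑ i ∈ s, (d₁ i + 1) := by
  have h1 : ∑ i ∈ s, e i ≤ ∑ i ∈ s, 2 * 14 ^ d * (d₁ i + 1 / 2) := Finset.sum_le_sum henl
  have hcard : (1 : ℝ) ≤ s.card := by exact_mod_cast hs.card_pos
  have h14 : (1 : ℝ) ≤ 14 ^ d := one_le_pow₀ (by norm_num)
  have hsplit : (2 : ℝ) * 14 ^ d * ∑ i ∈ s, (d₁ i + 1) =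
      ∑ i ∈ s, 2 * 14 ^ d * (d₁ i + 1 / 2) + s.card * 14 ^ d := by
    rw [Finset.mul_sum]
    have : ∀ i ∈ s, (2 : ℝ) * 14 ^ d * (d₁ i + 1) = 2 * 14 ^ d * (d₁ i + 1 / 2) + 14 ^ d := by
      intro i _; ring
    rw [Finset.sum_congr rfl this, Finset.sum_add_distrib, Finset.sum_const, nsmul_eq_mul]
  have hone : (1 : ℝ) ≤ s.card * 14 ^ d := by nlinarith
  rw [hsplit]
  linarith

/-! ## §3 The exponential comparison -/

/-- p. 385: *"Π_i exp(−½γ₀A₁²p₀²(g₁)(d′₁(Z₁⁽ⁱ⁾) + 1)) ≦ exp(−¼γ₀(14)^{−d}A₁²p₀²(g₁)(d′₁(Z) + 1))"* —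
from the gluing consequence (`hglue`, §2) and `0 ≤ γ₀`; `p₀g = p₀(g₁)`.
[cite: Balaban1989LargeFieldII, p.385 display before (1.82)] -/
theorem expProd_le {ι : Type*} {s : Finset ι} {d : ℕ} {dZ γ₀ A₁ p₀g : ℝ} {d₁ : ι → ℝ} (hγ : 0 ≤ γ₀)
    (hglue : dZ + 1 ≤ 2 * 14 ^ d * ∑ i ∈ s, (d₁ i + 1)) :
    ∏ i ∈ s, Real.exp (-(1 / 2) * γ₀ * A₁ ^ 2 * p₀g ^ 2 * (d₁ i + 1)) ≤
      Real.exp (-(1 / 4) * γ₀ * (14 ^ d)⁻¹ * A₁ ^ 2 * p₀g ^ 2 * (dZ + 1)) := by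
  rw [← Real.exp_sum, Real.exp_le_exp, ← Finset.mul_sum]
  have hc : 0 ≤ γ₀ * A₁ ^ 2 * p₀g ^ 2 := by positivity
  have h14 : (0 : ℝ) < 14 ^ d := by positivity
  have hq : (14 ^ d : ℝ)⁻¹ * (dZ + 1) ≤ 2 * ∑ i ∈ s, (d₁ i + 1) := by
    rw [inv_mul_le_iff₀ h14]; linarith
  have := mul_le_mul_of_nonneg_left hq hc
  nlinarith

/-- The same comparison directly from the two geometric binders (§2 inlined).
[cite: Balaban1989LargeFieldII, p.385 display before (1.82)] -/
theorem expProd_le_of_binders {ι : Type*} {s : Finset ι} (hs : s.Nonempty) {d : ℕ}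
    {dZ γ₀ A₁ p₀g : ℝ} {d₁ e : ι → ℝ} (hγ : 0 ≤ γ₀)
    (hcover : dZ ≤ ∑ i ∈ s, e i) (henl : ∀ i ∈ s, e i ≤ 2 * 14 ^ d * (d₁ i + 1 / 2)) :
    ∏ i ∈ s, Real.exp (-(1 / 2) * γ₀ * A₁ ^ 2 * p₀g ^ 2 * (d₁ i + 1)) ≤
      Real.exp (-(1 / 4) * γ₀ * (14 ^ d)⁻¹ * A₁ ^ 2 * p₀g ^ 2 * (dZ + 1)) :=
  expProd_le hγ (gluing hs hcover henl)

/-! ## §4 (1.82) from the definition of `κ₁(Z)` -/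

/-- (1.82) p. 385: *"From the definition of κ₁(Z) we get the following bound:
κ₁(Z) ≧ ¼γ₀(14)^{−d}A₁²p₀²(g₁)(d′₁(Z) + 1) − O(1)M^dR₁^{d+1}d′₁(Z)"* — from the (1.79)-shaped
lower bound `hdef` (sum over the regions of `½γ₀A₁²p₀²(g₁)(d′₁(Z₁⁽ⁱ⁾) + 1)`, minus the cost
`cost = O(1)M^dR₁^{d+1}d′₁(Z)`) and the gluing consequence `hglue` (§2).
[cite: Balaban1989LargeFieldII, (1.82) p.385] -/
theorem ineq182_of_gluing {ι : Type*} {s : Finset ι} {d : ℕ} {κ₁ dZ γ₀ A₁ p₀g cost : ℝ}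
    {d₁ : ι → ℝ} (hγ : 0 ≤ γ₀)
    (hdef : ∑ i ∈ s, (1 / 2) * γ₀ * A₁ ^ 2 * p₀g ^ 2 * (d₁ i + 1) - cost ≤ κ₁)
    (hglue : dZ + 1 ≤ 2 * 14 ^ d * ∑ i ∈ s, (d₁ i + 1)) :
    (1 / 4) * γ₀ * (14 ^ d)⁻¹ * A₁ ^ 2 * p₀g ^ 2 * (dZ + 1) - cost ≤ κ₁ := by
  rw [← Finset.mul_sum] at hdef
  have hc : 0 ≤ γ₀ * A₁ ^ 2 * p₀g ^ 2 := by positivity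
  have h14 : (0 : ℝ) < 14 ^ d := by positivity
  have hq : (14 ^ d : ℝ)⁻¹ * (dZ + 1) ≤ 2 * ∑ i ∈ s, (d₁ i + 1) := by
    rw [inv_mul_le_iff₀ h14]; linarith
  have := mul_le_mul_of_nonneg_left hq hc
  nlinarith

/-- (1.82) from the definition of `κ₁(Z)` and the two GEOMETRIC binders of p. 385 (cover
inequality `hcover`, per-region enlargement bound `henl`), for a component determined by a
non-empty finite family of regions. [cite: Balaban1989LargeFieldII, (1.82) p.385] -/
theorem ineq182_of_def {ι : Type*} {s : Finset ι} (hs : s.Nonempty) {d : ℕ}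
    {κ₁ dZ γ₀ A₁ p₀g cost : ℝ} {d₁ e : ι → ℝ} (hγ : 0 ≤ γ₀)
    (hdef : ∑ i ∈ s, (1 / 2) * γ₀ * A₁ ^ 2 * p₀g ^ 2 * (d₁ i + 1) - cost ≤ κ₁)
    (hcover : dZ ≤ ∑ i ∈ s, e i) (henl : ∀ i ∈ s, e i ≤ 2 * 14 ^ d * (d₁ i + 1 / 2)) :
    (1 / 4) * γ₀ * (14 ^ d)⁻¹ * A₁ ^ 2 * p₀g ^ 2 * (dZ + 1) - cost ≤ κ₁ :=
  ineq182_of_gluing hγ hdef (gluing hs hcover henl)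

/-- The same with the cube-count binder in its PRINTED form `d′₁((Z₁⁽ⁱ⁾)~³) ≤ 7^d(3·2^{d−1}d′₁(Z₁⁽ⁱ⁾) + 2^d)`
(`hcount`), sizes non-negative, `d ≥ 1`. [cite: Balaban1989LargeFieldII, (1.82) p.385] -/
theorem ineq182_of_def_count {ι : Type*} {s : Finset ι} (hs : s.Nonempty) {d : ℕ} (hd : 1 ≤ d)
    {κ₁ dZ γ₀ A₁ p₀g cost : ℝ} {d₁ e : ι → ℝ} (hγ : 0 ≤ γ₀) (hd₁ : ∀ i ∈ s, 0 ≤ d₁ i)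
    (hdef : ∑ i ∈ s, (1 / 2) * γ₀ * A₁ ^ 2 * p₀g ^ 2 * (d₁ i + 1) - cost ≤ κ₁)
    (hcover : dZ ≤ ∑ i ∈ s, e i)
    (hcount : ∀ i ∈ s, e i ≤ (7 : ℝ) ^ d * (3 * 2 ^ (d - 1) * d₁ i + 2 ^ d)) :
    (1 / 4) * γ₀ * (14 ^ d)⁻¹ * A₁ ^ 2 * p₀g ^ 2 * (dZ + 1) - cost ≤ κ₁ :=
  ineq182_of_def hs hγ hdef hcover fun i hi => enlarge_of_count hd (hd₁ i hi) (hcount i hi)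

/-! ## §5 The base case `j = 1` of (1.80), knit to `Step.Budget.base_182` -/

/-- p. 385: *"Thus, by the estimate (1.81), the statement holds for j = 1, i.e., the inequality
(1.80) holds for j = 1, if ¼γ₀(14)^{−d}A₁²p₀²(g₁) ≧ O(1)2(64)^dM^dL^{d+1}R₁^{d+2}"* — the cell
`pub-balaban`'s arithmetic skeleton `Step.Budget.base_182` (which takes (1.82) as the hypothesis
`hκ`) with that hypothesis DISCHARGED from the definition of `κ₁(Z)` (§4): the cost is
`Step.Budget.Consts.cost b 1 dZ = O(1)M^dR₁^{d+1}d′₁(Z)`, the dimension is `b.d`; `rhs` = the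
right-hand side of (1.80) at `j = 1`, majorised through (1.81) by `Q(d′₁(Z) + 1)` (`hrhs`) with
`Q = O(1)(64)^dM^dL^{d+1}R₁^{d+2}`, the cost likewise (`hcost`), and the located condition `2Q ≤ a`
(`hcond`, `a = ¼γ₀(14)^{−d}A₁²p₀²(g₁)`).
[cite: Balaban1989LargeFieldII, (1.82) p.385 and the sentence after it] -/
theorem base180_of_def (b : Step.Budget.Consts) {ι : Type*} {s : Finset ι} (hs : s.Nonempty)
    {κ₁ dZ γ₀ A₁ p₀g Q rhs : ℝ} {d₁ e : ι → ℝ} (hγ : 0 ≤ γ₀) (hdZ : 0 ≤ dZ)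
    (hdef : ∑ i ∈ s, (1 / 2) * γ₀ * A₁ ^ 2 * p₀g ^ 2 * (d₁ i + 1) - b.cost 1 dZ ≤ κ₁)
    (hcover : dZ ≤ ∑ i ∈ s, e i) (henl : ∀ i ∈ s, e i ≤ 2 * 14 ^ b.d * (d₁ i + 1 / 2))
    (hrhs : rhs ≤ Q * (dZ + 1)) (hcost : b.cost 1 dZ ≤ Q * (dZ + 1))
    (hcond : 2 * Q ≤ (1 / 4) * γ₀ * (14 ^ b.d)⁻¹ * A₁ ^ 2 * p₀g ^ 2) : rhs ≤ κ₁ :=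
  Step.Budget.base_182 κ₁ ((1 / 4) * γ₀ * (14 ^ b.d)⁻¹ * A₁ ^ 2 * p₀g ^ 2) Q (b.cost 1 dZ) rhs dZ
    hdZ (ineq182_of_def hs hγ hdef hcover henl) hrhs hcost hcond

/-- The base case with (1.80) in the cell's typed form `Step.Budget.Controls b 1 K κ₁ size`
(the budget `κ₁` controls `K` steps from scale 1), when the (1.81) majorant bounds that sum by
`Q(d′₁(Z) + 1)`. [cite: Balaban1989LargeFieldII, (1.80)–(1.82) pp.384–385] -/
theorem controls_base_of_def (b : Step.Budget.Consts) {ι : Type*} {s : Finset ι} (hs : s.Nonempty)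
    {κ₁ dZ γ₀ A₁ p₀g Q : ℝ} {d₁ e : ι → ℝ} {K : ℕ} {size : ℕ → ℝ} (hγ : 0 ≤ γ₀) (hdZ : 0 ≤ dZ)
    (hdef : ∑ i ∈ s, (1 / 2) * γ₀ * A₁ ^ 2 * p₀g ^ 2 * (d₁ i + 1) - b.cost 1 dZ ≤ κ₁)
    (hcover : dZ ≤ ∑ i ∈ s, e i) (henl : ∀ i ∈ s, e i ≤ 2 * 14 ^ b.d * (d₁ i + 1 / 2))
    (h181 : ∑ n ∈ Finset.Ioc 1 (1 + K), b.cost n (size n) ≤ Q * (dZ + 1))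
    (hcost : b.cost 1 dZ ≤ Q * (dZ + 1))
    (hcond : 2 * Q ≤ (1 / 4) * γ₀ * (14 ^ b.d)⁻¹ * A₁ ^ 2 * p₀g ^ 2) :
    Step.Budget.Controls b 1 K κ₁ size :=
  base180_of_def b hs hγ hdZ hdef hcover henl h181 hcost hcond

/-! ## §6 Non-vacuity -/

/-- One region of size `d′₁(Z₁⁽¹⁾) = 1` determining a component of size `d′₁(Z) = 3` with
`d′₁((Z₁⁽¹⁾)~³) = 3`, `d = 1`, `γ₀ = A₁ = p₀(g₁) = 1`, cost `1`: every hypothesis of `ineq182_of_def`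
holds and the conclusion reads `1/4·(1/14)·4 − 1 ≤ κ₁`, i.e. `κ₁ ≥ −13/14`, met by the defining value
`κ₁ = ½·2 − 1 = 0` with room to spare. [folklore] -/
example : (1 / 4 : ℝ) * 1 * (14 ^ 1)⁻¹ * 1 ^ 2 * 1 ^ 2 * (3 + 1) - 1 ≤ 0 :=
  ineq182_of_def (s := ({0} : Finset ℕ)) (d₁ := fun _ => (1 : ℝ)) (e := fun _ => (3 : ℝ))
    (Finset.singleton_nonempty 0) zero_le_one (by norm_num) (by simp) (by intro i _; norm_num)

end Literature.MathematicalPhysics.QuantumFieldTheory.Balaban1983to89.B16Ineq182Gluing
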